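import Mathlib
import Summits.ValiantsHypothesis.ValiantsHypothesis.Theorems.FifoMatchingNNNotVPDivisionSplitDefs
import Summits.ValiantsHypothesis.ValiantsHypothesis.Theorems.FifoMatchingGridCorShadowExpRung
import Literature.Computability.AlgebraicComplexity.SparseCircuitBounds
import Literature.Computability.AlgebraicComplexity.NestFreeMatchingPoly
import HarnessLib

/-!
# Route FifoMatching — crux `NNNotVP` (stmt-ValiantsHypothesis-11615), line `division_split`:
# stub B2 `stub_spreadCofactorReduction` holds below degree `2^⌊n^{1/8}⌋`; B2 ⟺ its hyper-degree tier

Registered line `Cruxes/NNNotVP/Lines/division_split.lean`; objects `σ` / `NN` = the line's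
vocabulary (`Theorems/FifoMatchingNNNotVPDivisionSplitDefs.lean`).  Stub **B2** (the line's «open
core»): for some `k`, every nonzero cofactor `h` of `NN_n` can be traded for an `h'` having a
monomial of support `≤ (log₂ n + k)^k` with `L₊(NN_n · h') ≤ 2^((log₂ n + log₂(L₊(NN_n h) + L₊(h)) + k)^k)`.

* `complexity_NN_le` — the trivial bound `L₊(NN_n) ≤ 2^((2n+1)(n+1))` (sum of monomials);
* `spreadCofactorReduction_of_totalDegree_le` — **B2 holds for every cofactor of total degree
  `≤ 2^⌊n^{1/8}⌋`**, with `h' := 1`: by the landed exponential rung `GridCorShadow.expRung_holds`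
  (item stmt-27406) such a certificate already costs `> 2^⌊n^{1/8}⌋`, so the allowed budget
  `2^((… + log₂ cost + k)^k) ≥ 2^((⌊n^{1/8}⌋ + 1)^24) ≥ 2^((n+1)^3)` pays for `NN_n` itself
  (`k` also absorbs the finitely many `n` below the rung's threshold);
* `spreadCofactorReduction_iff_hyperDegree` — hence B2 ⟺ B2 restricted to cofactors of total
  degree `> 2^⌊n^{1/8}⌋` (cheap only through repeated squaring): the open core of B2, by name.

Honest framing: a localisation of stub B2, not a proof of it; B2 (hyper-degree tier), stubs Z / A,
the crux `NNNotVP` and `VP ≠ VNP` stay OPEN (NOT proved).  No definitions, no named facts.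
-/

noncomputable section

-- Sub = Summit single-conjunct layout: the duplicated namespace component is mandated by the tree.
set_option linter.dupNamespace false

namespace Summit.ValiantsHypothesis.ValiantsHypothesis.Theorems.FifoMatching.NNNotVP.DivisionSplit

open MvPolynomial Literature.Computability.AlgebraicComplexity
open scoped NNReal BigOperators Classical

/-- **Trivial upper bound:** `L₊(NN_n) ≤ 2^((2n+1)(n+1))` (at most `(2n)^{2n}` monomials of degree
`n`, summed one by one). [folklore] -/
theorem complexity_NN_le (n : ℕ) : complexity (NN n) ≤ 2 ^ ((2 * n + 1) * (n + 1)) := by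
  have h1 : complexity (NN n) ≤ (NN n).support.card * (2 * (NN n).totalDegree + 2) :=
    complexity_le_card_support_mul _
  have h2 : (NN n).support.card ≤ (2 * n) ^ (2 * n) := by
    rw [show (NN n).support.card = (nestFreeMatchings (2 * n)).card from
      card_support_nestFreeMatchingPoly n]
    calc (nestFreeMatchings (2 * n)).card ≤ Fintype.card (Fin (2 * n) → Fin (2 * n)) :=
          Finset.card_le_univ _
      _ = (2 * n) ^ (2 * n) := by simp [Fintype.card_fin]
  have h3 : (NN n).totalDegree ≤ n := totalDegree_nestFreeMatchingPoly_le n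
  have hn2 : n < 2 ^ n := Nat.lt_two_pow_self
  have h4 : 2 * n ≤ 2 ^ (n + 1) := by rw [pow_succ]; omega
  have h5 : (2 * n) ^ (2 * n) ≤ 2 ^ ((n + 1) * (2 * n)) := by
    calc (2 * n) ^ (2 * n) ≤ (2 ^ (n + 1)) ^ (2 * n) := Nat.pow_le_pow_left h4 _
      _ = 2 ^ ((n + 1) * (2 * n)) := by rw [← pow_mul]
  have h6 : 2 * n + 2 ≤ 2 ^ (n + 1) := by rw [pow_succ]; omega
  calc complexity (NN n) ≤ (NN n).support.card * (2 * (NN n).totalDegree + 2) := h1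
    _ ≤ (2 * n) ^ (2 * n) * (2 * n + 2) := Nat.mul_le_mul h2 (by omega)
    _ ≤ 2 ^ ((n + 1) * (2 * n)) * 2 ^ (n + 1) := Nat.mul_le_mul h5 h6
    _ = 2 ^ ((2 * n + 1) * (n + 1)) := by rw [← pow_add]; ring_nf

/-- **Stub B2 below degree `2^⌊n^{1/8}⌋`** (with `h' := 1`): by the landed exponential rung
`GridCorShadow.expRung_holds`, a certificate `NN_n · h` with `deg h ≤ 2^⌊n^{1/8}⌋` costs more than
`2^⌊n^{1/8}⌋`, and `2^((⌊n^{1/8}⌋ + 1)^24) ≥ 2^((n+1)^3) ≥ L₊(NN_n)`; the `n` below the rung's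
threshold are absorbed into `k`. [folklore] -/
theorem spreadCofactorReduction_of_totalDegree_le :
    ∃ k : ℕ, ∀ (n : ℕ) (h : MvPolynomial (σ n) ℝ≥0), h ≠ 0 →
      h.totalDegree ≤ 2 ^ Nat.sqrt (Nat.sqrt (Nat.sqrt n)) →
      ∃ h' : MvPolynomial (σ n) ℝ≥0, (∃ m ∈ h'.support, m.support.card ≤ (Nat.log 2 n + k) ^ k) ∧
        complexity (NN n * h') ≤
          2 ^ ((Nat.log 2 n + Nat.log 2 (complexity (NN n * h) + complexity h) + k) ^ k) := by
  obtain ⟨n₁, hn₁⟩ := GridCorShadow.expRung_holds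
  refine ⟨(2 * n₁ + 1) * (n₁ + 1) + 24, fun n h hh hd => ⟨1, ⟨0, by simp, by simp⟩, ?_⟩⟩
  rw [mul_one]
  have hbase : 1 ≤ Nat.log 2 n + Nat.log 2 (complexity (NN n * h) + complexity h) +
      ((2 * n₁ + 1) * (n₁ + 1) + 24) := by omega
  have hEk : (2 * n₁ + 1) * (n₁ + 1) + 24 ≤
      (Nat.log 2 n + Nat.log 2 (complexity (NN n * h) + complexity h) +
        ((2 * n₁ + 1) * (n₁ + 1) + 24)) ^ ((2 * n₁ + 1) * (n₁ + 1) + 24) := by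
    calc (2 * n₁ + 1) * (n₁ + 1) + 24
        ≤ (Nat.log 2 n + Nat.log 2 (complexity (NN n * h) + complexity h) +
            ((2 * n₁ + 1) * (n₁ + 1) + 24)) ^ 1 := by rw [pow_one]; omega
      _ ≤ _ := Nat.pow_le_pow_right hbase (by omega)
  refine (complexity_NN_le n).trans (Nat.pow_le_pow_right (by norm_num) ?_)
  by_cases hn : n₁ ≤ n
  · -- beyond the rung's threshold: the certificate is expensive
    have hr : 2 ^ Nat.sqrt (Nat.sqrt (Nat.sqrt n)) < complexity (NN n * h) := hn₁ n hn h hh hd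
    have hlog : Nat.sqrt (Nat.sqrt (Nat.sqrt n)) ≤
        Nat.log 2 (complexity (NN n * h) + complexity h) :=
      Nat.le_log_of_pow_le (by norm_num) (hr.le.trans (Nat.le_add_right _ _))
    -- `n < (⌊n^{1/8}⌋ + 1)^8` (three nested `Nat.lt_succ_sqrt`; cf. the tree's
    -- `GreenAC0.lt_succ_kk_pow`, not imported here to keep this module inside the Valiant cone)
    have h5 : n < (Nat.sqrt (Nat.sqrt (Nat.sqrt n)) + 1) ^ 8 := by
      have e1 : n < (Nat.sqrt n + 1) * (Nat.sqrt n + 1) := Nat.lt_succ_sqrt n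
      have e2 : Nat.sqrt n < (Nat.sqrt (Nat.sqrt n) + 1) * (Nat.sqrt (Nat.sqrt n) + 1) :=
        Nat.lt_succ_sqrt _
      have e3 : Nat.sqrt (Nat.sqrt n) <
          (Nat.sqrt (Nat.sqrt (Nat.sqrt n)) + 1) * (Nat.sqrt (Nat.sqrt (Nat.sqrt n)) + 1) :=
        Nat.lt_succ_sqrt _
      have e4 : Nat.sqrt n + 1 ≤ (Nat.sqrt (Nat.sqrt (Nat.sqrt n)) + 1) ^ 4 := by
        calc Nat.sqrt n + 1 ≤ (Nat.sqrt (Nat.sqrt n) + 1) * (Nat.sqrt (Nat.sqrt n) + 1) := e2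
          _ ≤ ((Nat.sqrt (Nat.sqrt (Nat.sqrt n)) + 1) * (Nat.sqrt (Nat.sqrt (Nat.sqrt n)) + 1)) *
              ((Nat.sqrt (Nat.sqrt (Nat.sqrt n)) + 1) * (Nat.sqrt (Nat.sqrt (Nat.sqrt n)) + 1)) :=
            Nat.mul_le_mul e3 e3
          _ = (Nat.sqrt (Nat.sqrt (Nat.sqrt n)) + 1) ^ 4 := by ring
      calc n < (Nat.sqrt n + 1) * (Nat.sqrt n + 1) := e1
        _ ≤ (Nat.sqrt (Nat.sqrt (Nat.sqrt n)) + 1) ^ 4 * (Nat.sqrt (Nat.sqrt (Nat.sqrt n)) + 1) ^ 4 :=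
            Nat.mul_le_mul e4 e4
        _ = (Nat.sqrt (Nat.sqrt (Nat.sqrt n)) + 1) ^ 8 := by ring
    have hsq : 2 * n + 1 ≤ (n + 1) * (n + 1) := by nlinarith
    calc (2 * n + 1) * (n + 1) ≤ (n + 1) * (n + 1) * (n + 1) := Nat.mul_le_mul_right _ hsq
      _ = (n + 1) ^ 3 := by ring
      _ ≤ ((Nat.sqrt (Nat.sqrt (Nat.sqrt n)) + 1) ^ 8) ^ 3 := Nat.pow_le_pow_left (by omega) 3
      _ = (Nat.sqrt (Nat.sqrt (Nat.sqrt n)) + 1) ^ 24 := by rw [← pow_mul]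
      _ ≤ (Nat.sqrt (Nat.sqrt (Nat.sqrt n)) + 1) ^ ((2 * n₁ + 1) * (n₁ + 1) + 24) :=
          Nat.pow_le_pow_right (by omega) (by omega)
      _ ≤ (Nat.log 2 n + Nat.log 2 (complexity (NN n * h) + complexity h) +
            ((2 * n₁ + 1) * (n₁ + 1) + 24)) ^ ((2 * n₁ + 1) * (n₁ + 1) + 24) :=
          Nat.pow_le_pow_left (by omega) _
  · -- below the threshold: `k` absorbs `L₊(NN_n)`
    push Not at hn
    calc (2 * n + 1) * (n + 1) ≤ (2 * n₁ + 1) * (n₁ + 1) := Nat.mul_le_mul (by omega) (by omega)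
      _ ≤ (2 * n₁ + 1) * (n₁ + 1) + 24 := by omega
      _ ≤ _ := hEk

/-- **B2 ⟺ its hyper-degree tier.**  Stub `stub_spreadCofactorReduction` (verbatim on the left) is
equivalent to its restriction to cofactors of total degree `> 2^⌊n^{1/8}⌋`
(`spreadCofactorReduction_of_totalDegree_le` handles the rest; the rate is monotone in `k`).
[folklore] -/
theorem spreadCofactorReduction_iff_hyperDegree :
    (∃ k : ℕ, ∀ (n : ℕ) (h : MvPolynomial (σ n) ℝ≥0), h ≠ 0 →
      ∃ h' : MvPolynomial (σ n) ℝ≥0, (∃ m ∈ h'.support, m.support.card ≤ (Nat.log 2 n + k) ^ k) ∧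
        complexity (NN n * h') ≤
          2 ^ ((Nat.log 2 n + Nat.log 2 (complexity (NN n * h) + complexity h) + k) ^ k)) ↔
    (∃ k : ℕ, ∀ (n : ℕ) (h : MvPolynomial (σ n) ℝ≥0), h ≠ 0 →
      2 ^ Nat.sqrt (Nat.sqrt (Nat.sqrt n)) < h.totalDegree →
      ∃ h' : MvPolynomial (σ n) ℝ≥0, (∃ m ∈ h'.support, m.support.card ≤ (Nat.log 2 n + k) ^ k) ∧
        complexity (NN n * h') ≤
          2 ^ ((Nat.log 2 n + Nat.log 2 (complexity (NN n * h) + complexity h) + k) ^ k)) := by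
  constructor
  · rintro ⟨k, hk⟩
    exact ⟨k, fun n h hh _ => hk n h hh⟩
  · rintro ⟨k₁, hk₁⟩
    obtain ⟨k₀, hk₀⟩ := spreadCofactorReduction_of_totalDegree_le
    -- monotonicity of the rate in `k` (cf. the tree's `logLevel_mono`, another route's module,
    -- not imported here)
    have rate : ∀ (a : ℕ) {k k' : ℕ}, k ≤ k' → (a + k) ^ k ≤ (a + k') ^ k' := by
      intro a k k' hk
      rcases Nat.eq_zero_or_pos k' with hk' | hk'
      · subst hk'
        have : k = 0 := by omega
        subst this
        exact le_rfl
      · calc (a + k) ^ k ≤ (a + k') ^ k := Nat.pow_le_pow_left (by omega) k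
          _ ≤ (a + k') ^ k' := Nat.pow_le_pow_right (by omega) hk
    -- monotonicity of the conclusion in `k`
    have mono : ∀ {k k' : ℕ}, k ≤ k' → ∀ (n : ℕ) (h h' : MvPolynomial (σ n) ℝ≥0),
        ((∃ m ∈ h'.support, m.support.card ≤ (Nat.log 2 n + k) ^ k) ∧
          complexity (NN n * h') ≤
            2 ^ ((Nat.log 2 n + Nat.log 2 (complexity (NN n * h) + complexity h) + k) ^ k)) →
        ((∃ m ∈ h'.support, m.support.card ≤ (Nat.log 2 n + k') ^ k') ∧
          complexity (NN n * h') ≤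
            2 ^ ((Nat.log 2 n + Nat.log 2 (complexity (NN n * h) + complexity h) + k') ^ k')) := by
      intro k k' hkk' n h h' ⟨⟨m, hm, hmc⟩, hc⟩
      exact ⟨⟨m, hm, hmc.trans (rate _ hkk')⟩,
        hc.trans (Nat.pow_le_pow_right (by norm_num) (rate _ hkk'))⟩
    refine ⟨max k₀ k₁, fun n h hh => ?_⟩
    by_cases hd : h.totalDegree ≤ 2 ^ Nat.sqrt (Nat.sqrt (Nat.sqrt n))
    · obtain ⟨h', hh'⟩ := hk₀ n h hh hd
      exact ⟨h', mono (le_max_left _ _) n h h' hh'⟩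
    · obtain ⟨h', hh'⟩ := hk₁ n h hh (lt_of_not_ge hd)
      exact ⟨h', mono (le_max_right _ _) n h h' hh'⟩

end Summit.ValiantsHypothesis.ValiantsHypothesis.Theorems.FifoMatching.NNNotVP.DivisionSplit

end
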